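import Summits.ResolutionOfSingularities.ResolutionOfSingularities.Theorems.EquisingularLiftEquisingularLiftNatDEvenTower
import Summits.ResolutionOfSingularities.ResolutionOfSingularities.Theorems.EquisingularLiftEquisingularLiftNatE6Tower
import HarnessLib

/-!
# [OURS] `E₇ = y₀³y₁ + y₁³ + y₂²` HAS BLOW-UP DEPTH `3` AND `E₈ = y₀³ + y₁⁵ + y₂²` HAS BLOW-UP DEPTH `4` IN EVERY BLOW-UP TOWER — every field, every
# characteristic, exact trinomial arithmetic: `E₈ → E₇ → D₆ → D₄ → nodes` LITERALLY along the charts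
# (cruxes `Theses.EquisingularLift.EquisingularLiftNat` / `…NatThree` / `EquisingularLift`, stmt-ResolutionOfSingularities-20038 / -20148 / -15660)

[OURS · leafhand-res-equisingularlift-12 g1, 2026-09-01; cell `pub/decomp-res`] AI-produced, weaker than expert review; NOT a statement of any manuscript;
nothing here proves resolution of singularities in positive characteristic.  DEF-FREE helper; no `sorry`; standard axioms; ZERO named hypotheses.

With the double plane `y₂²` as tangent cone (`x := y₂`, `y := y₀`, `z := y₁`):

* `E₇ = x² + y³z + z³`: chart `0` (`y₁ ↦ T₀T₁`, `y₂ ↦ T₀T₂`) carries `T₀²T₁ + T₀T₁³ + T₂²` = the `D₆` normal form `f_1` of ✓ `towerLevel_origin_D_even`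
  LITERALLY at its origin (the only singular point on the exceptional divisor), chart `1` is a graph (regular), chart `2` is empty;
* `E₈ = x² + y³ + z⁵`: chart `1` carries `T₀³T₁ + T₁³ + T₂² = E₇` LITERALLY at its origin, chart `0` is a graph, chart `2` is empty.

* `SecondOrderPoint.E₇_strictTransform₀/₁`, `E₈_strictTransform₀/₁` — the chart identities;
* ★★★ `OneStep.towerLevel_origin_E₇` — the origin of `Spec K[y]/(y₀³y₁ + y₁³ + y₂²)` has `D`-level `3` in every blow-up tower;
* ★★★ `OneStep.towerLevel_origin_E₈` — the origin of `Spec K[y]/(y₀³ + y₁⁵ + y₂²)` has `D`-level `4` in every blow-up tower.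

(In characteristics `2, 3, 5` these trinomials are still isolated double points — Artin's `E₇⁰`, `E₈⁰` forms — and the computation is the same.)
NOT included (honest): vertex / `IsoHypPoint` corollaries — an exact trinomial vertex chart of degree `≥ 4` forces a homogenisation singular along
the line `{x₂ = x₃ = 0}`, so such corollaries would be vacuous; the local level statement is the content.  Closes no registered stub.

References: [Hartshorne1977, I Thm. 5.1, I Ex. 5.6, II Ex. 7.12]; [Lipman1969, §24]; [Artin1977, §3 (rational double points in characteristic p)];
[StacksProject, Tags 0804, 080E]; through the cited tree files.
-/

set_option linter.dupNamespace false -- mandated namespace `Summit.<Summit>.<Problem>` of this single-conjunct summit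

noncomputable section

open CategoryTheory CategoryTheory.Limits AlgebraicGeometry TopologicalSpace Topology
open MvPolynomial
open Literature.AlgebraicGeometry.Resolution
open AlgebraicGeometry.Scheme.IdealSheafData

namespace Summit.ResolutionOfSingularities.ResolutionOfSingularities.Cruxes.EquisingularLiftNat.Sections

namespace SecondOrderPoint

variable (K : Type) [Field K]

/-! ## `E₇ = y₀³y₁ + y₁³ + y₂²`: charts -/

/-- The tail `y₀³y₁ + y₁³` lies in `(y)³`. [folklore] -/
theorem E₇_tail_mem_pow :
    (X 0 ^ 3 * X 1 + X 1 ^ 3 : MvPolynomial (Fin 3) K) ∈ Ideal.span (Set.range (X : Fin 3 → MvPolynomial (Fin 3) K)) ^ (2 + 1) := by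
  refine Ideal.add_mem _ ?_ ?_
  · simpa using monomial_mem_pow₃ K 3 1 0 (k := 2 + 1) (by norm_num)
  · simpa using monomial_mem_pow₃ K 0 3 0 (k := 2 + 1) (by norm_num)

/-- **Chart `0` of `E₇`**: `E₇(T₀, T₀T₁, T₀T₂) = T₀²·(T₀·(T₀T₁ + T₁³) + T₂²)` — the `D₆` form `T₀²T₁ + T₀T₁³ + T₂²`. [cite: Hartshorne1977, II Ex. 7.12] -/
theorem E₇_strictTransform₀ :
    aeval (fun j => X 0 * Function.update (X : Fin 3 → MvPolynomial (Fin 3) K) 0 1 j)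
        (X 2 ^ 2 + (X 0 ^ 3 * X 1 + X 1 ^ 3) : MvPolynomial (Fin 3) K) = X 0 ^ 2 * (X 0 * (X 0 * X 1 + X 1 ^ 3) + X 2 ^ 2) := by
  simp only [map_add, map_mul, map_pow, aeval_X, Function.update_self, Function.update_of_ne (by decide : (1 : Fin 3) ≠ 0),
    Function.update_of_ne (by decide : (2 : Fin 3) ≠ 0)]
  ring

/-- **Chart `1` of `E₇`**: `E₇(T₁T₀, T₁, T₁T₂) = T₁²·(T₁·(1 + T₁·T₀³) + T₂²)` — a graph chart. [cite: Hartshorne1977, II Ex. 7.12] -/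
theorem E₇_strictTransform₁ :
    aeval (fun j => X 1 * Function.update (X : Fin 3 → MvPolynomial (Fin 3) K) 1 1 j)
        (X 2 ^ 2 + (X 0 ^ 3 * X 1 + X 1 ^ 3) : MvPolynomial (Fin 3) K) = X 1 ^ 2 * (X 1 * (1 + X 1 * X 0 ^ 3) + X 2 ^ 2) := by
  simp only [map_add, map_mul, map_pow, aeval_X, Function.update_self, Function.update_of_ne (by decide : (0 : Fin 3) ≠ 1),
    Function.update_of_ne (by decide : (2 : Fin 3) ≠ 1)]
  ring

/-! ## `E₈ = y₀³ + y₁⁵ + y₂²`: charts -/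

/-- The tail `y₀³ + y₁⁵` lies in `(y)³`. [folklore] -/
theorem E₈_tail_mem_pow :
    (X 0 ^ 3 + X 1 ^ 5 : MvPolynomial (Fin 3) K) ∈ Ideal.span (Set.range (X : Fin 3 → MvPolynomial (Fin 3) K)) ^ (2 + 1) := by
  refine Ideal.add_mem _ ?_ ?_
  · simpa using monomial_mem_pow₃ K 3 0 0 (k := 2 + 1) (by norm_num)
  · simpa using monomial_mem_pow₃ K 0 5 0 (k := 2 + 1) (by norm_num)

/-- **Chart `1` of `E₈`**: `E₈(T₁T₀, T₁, T₁T₂) = T₁²·(T₁·(T₀³ + T₁²) + T₂²)` — the `E₇` form `T₀³T₁ + T₁³ + T₂²`. [cite: Hartshorne1977, II Ex. 7.12] -/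
theorem E₈_strictTransform₁ :
    aeval (fun j => X 1 * Function.update (X : Fin 3 → MvPolynomial (Fin 3) K) 1 1 j)
        (X 2 ^ 2 + (X 0 ^ 3 + X 1 ^ 5) : MvPolynomial (Fin 3) K) = X 1 ^ 2 * (X 1 * (X 0 ^ 3 + X 1 ^ 2) + X 2 ^ 2) := by
  simp only [map_add, map_pow, aeval_X, Function.update_self, Function.update_of_ne (by decide : (0 : Fin 3) ≠ 1),
    Function.update_of_ne (by decide : (2 : Fin 3) ≠ 1)]
  ring

/-- **Chart `0` of `E₈`**: `E₈(T₀, T₀T₁, T₀T₂) = T₀²·(T₀·(1 + T₀·(T₀T₁⁵)) + T₂²)` — a graph chart. [cite: Hartshorne1977, II Ex. 7.12] -/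
theorem E₈_strictTransform₀ :
    aeval (fun j => X 0 * Function.update (X : Fin 3 → MvPolynomial (Fin 3) K) 0 1 j)
        (X 2 ^ 2 + (X 0 ^ 3 + X 1 ^ 5) : MvPolynomial (Fin 3) K) = X 0 ^ 2 * (X 0 * (1 + X 0 * (X 0 * X 1 ^ 5)) + X 2 ^ 2) := by
  simp only [map_add, map_pow, aeval_X, Function.update_self, Function.update_of_ne (by decide : (1 : Fin 3) ≠ 0),
    Function.update_of_ne (by decide : (2 : Fin 3) ≠ 0)]
  ring

end SecondOrderPoint

namespace OneStep

variable (K : Type) [Field K]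

/-- ★★★ **`E₇ = y₀³y₁ + y₁³ + y₂²` HAS LEVEL `3` IN EVERY BLOW-UP TOWER** (every field, every characteristic): for every `f = y₀³y₁ + y₁³ + y₂²`, the origin of
`Spec K[y]/(f)` has `D`-level `3` — chart `0` carries `D₆` (level `2`, ✓ `towerLevel_origin_D_even`) at its origin, the only singular point over the origin.
[OURS] [cite: Hartshorne1977, I Thm. 5.1, I Ex. 5.6] [cite: Lipman1969, §24] [cite: StacksProject, Tag 080E] -/
theorem towerLevel_origin_E₇ (D : ℕ → ∀ Γ : Scheme.{0}, Γ → Prop)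
    (hD0 : ∀ (Γ : Scheme.{0}) (y : Γ), IsClosed (({y} : Set Γ)) →
      (D 0 Γ y ↔ ∀ (hy : IsClosed (({y} : Set Γ))) (Z : Scheme.{0}) (τ : Z ⟶ Γ), IsBlowup τ (vanishingIdeal ⟨{y}, hy⟩) →
        ∀ z : Z, τ z = y → IsRegularLocalRing (Z.presheaf.stalk z)))
    (hDsucc : ∀ (d : ℕ) (Γ : Scheme.{0}) (y : Γ), IsClosed (({y} : Set Γ)) →
      (D (d + 1) Γ y ↔ ∀ (hy : IsClosed (({y} : Set Γ))) (Z : Scheme.{0}) (τ : Z ⟶ Γ), IsBlowup τ (vanishingIdeal ⟨{y}, hy⟩) →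
        ∃ S' : Finset Z, (∀ z : Z, τ z = y → z ∉ S' → IsRegularLocalRing (Z.presheaf.stalk z)) ∧
          ∀ z ∈ S', τ z = y ∧ IsClosed (({z} : Set Z)) ∧ ∃ d' ≤ d, D d' Z z)) :
    ∀ (f : MvPolynomial (Fin 3) K), f = X 0 ^ 3 * X 1 + X 1 ^ 3 + X 2 ^ 2 →
      ∀ (y₀ : Spec (CommRingCat.of (MvPolynomial (Fin 3) K ⧸ Ideal.span {f}))),
        y₀.asIdeal = Ideal.map (Ideal.Quotient.mk (Ideal.span {f})) (Ideal.span (Set.range (X : Fin 3 → MvPolynomial (Fin 3) K))) →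
        D 3 (Spec (CommRingCat.of (MvPolynomial (Fin 3) K ⧸ Ideal.span {f}))) y₀ := by
  classical
  intro f hf y₀ hy₀
  have e : (X 2 ^ 2 : MvPolynomial (Fin 3) K) + (X 0 ^ 3 * X 1 + X 1 ^ 3) = f := by rw [hf]; ring
  subst e
  have hΦ : (X 2 ^ 2 : MvPolynomial (Fin 3) K).IsHomogeneous 2 := isHomogeneous_X_pow (2 : Fin 3) 2
  have hΦ0 : (X 2 ^ 2 : MvPolynomial (Fin 3) K) ≠ 0 := pow_ne_zero _ (X_ne_zero 2)
  have hΨ := SecondOrderPoint.E₇_tail_mem_pow K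
  obtain ⟨G₂, hG₂, hJ₂⟩ := SecondOrderPoint.sq_chart_vacuous₂ K hΨ
  have hG₀ := SecondOrderPoint.E₇_strictTransform₀ K
  have hG₁ := SecondOrderPoint.E₇_strictTransform₁ K
  have htr₀ : aeval (fun i : Fin 3 => X i + C ((0 : Fin 3 → K) i)) (X 0 * (X 0 * X 1 + X 1 ^ 3) + X 2 ^ 2 : MvPolynomial (Fin 3) K) =
      X 2 ^ 2 + (X 0 ^ 2 * X 1 + X 0 * X 1 ^ (1 + 2)) := by
    rw [SecondOrderPoint.aeval_translate_zero]; ring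
  refine towerLevel_succ_origin_marked K D hD0 hDsucc 2 (X 2 ^ 2) (X 0 ^ 3 * X 1 + X 1 ^ 3) (by norm_num) hΦ hΦ0 hΨ
    ![X 0 * (X 0 * X 1 + X 1 ^ 3) + X 2 ^ 2, X 1 * (1 + X 1 * X 0 ^ 3) + X 2 ^ 2, G₂] (fun a => ?_)
    ![{(0 : Fin 3 → K)}, ∅, ∅] (fun a P hP haP hGP => ?_) (fun a lam hlam _ => ?_) y₀ hy₀
  · fin_cases a
    · exact hG₀
    · exact hG₁
    · exact hG₂
  · fin_cases a
    · by_cases hall : ∀ j, pderiv j (X 0 * (X 0 * X 1 + X 1 ^ 3) + X 2 ^ 2 : MvPolynomial (Fin 3) K) ∈ P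
      · right
        have h2 := SecondOrderPoint.X_two_mem_of_linear' K _ P hP haP hGP
        have hA := SecondOrderPoint.mem_of_pderiv_linear' K (l := 0) (by decide) _ P haP (hall 0)
        have h1 : (X 1 : MvPolynomial (Fin 3) K) ∈ P := by
          refine hP.mem_of_pow_mem 3 ?_
          have e : (X 1 ^ 3 : MvPolynomial (Fin 3) K) = (X 0 * X 1 + X 1 ^ 3) - X 0 * X 1 := by ring
          rw [e]
          exact P.sub_mem hA (P.mul_mem_right _ haP)
        refine ⟨0, ?_, ?_⟩
        · exact Finset.mem_singleton_self _
        · exact SecondOrderPoint.forall_X_sub_C_zero_mem K P haP h1 h2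
      · left
        push Not at hall
        exact hall
    · exact Or.inl ⟨1, SecondOrderPoint.pderiv_graph_not_mem' K (l := 1) (by decide) _ P hP haP⟩
    · exact (hJ₂ P hP haP hGP).elim
  · fin_cases a
    · have hlam0 : lam = 0 := by simpa using hlam
      subst hlam0
      exact ⟨2, X 2 ^ 2, X 0 ^ 2 * X 1 + X 0 * X 1 ^ (1 + 2), by norm_num, hΦ, SecondOrderPoint.D_even_tail_mem_pow K 1, htr₀,
        fun y' hy' => ⟨2, le_rfl, towerLevel_origin_D_even K D hD0 hDsucc 1 _ (by ring) y' hy'⟩⟩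
    · exact absurd hlam (Finset.notMem_empty _)
    · exact absurd hlam (Finset.notMem_empty _)

/-- ★★★ **`E₈ = y₀³ + y₁⁵ + y₂²` HAS LEVEL `4` IN EVERY BLOW-UP TOWER** (every field, every characteristic): for every `f = y₀³ + y₁⁵ + y₂²`, the origin of
`Spec K[y]/(f)` has `D`-level `4` — chart `1` carries `E₇` (level `3`) at its origin, the only singular point over the origin.
[OURS] [cite: Hartshorne1977, I Thm. 5.1, I Ex. 5.6] [cite: Lipman1969, §24] [cite: StacksProject, Tag 080E] -/
theorem towerLevel_origin_E₈ (D : ℕ → ∀ Γ : Scheme.{0}, Γ → Prop)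
    (hD0 : ∀ (Γ : Scheme.{0}) (y : Γ), IsClosed (({y} : Set Γ)) →
      (D 0 Γ y ↔ ∀ (hy : IsClosed (({y} : Set Γ))) (Z : Scheme.{0}) (τ : Z ⟶ Γ), IsBlowup τ (vanishingIdeal ⟨{y}, hy⟩) →
        ∀ z : Z, τ z = y → IsRegularLocalRing (Z.presheaf.stalk z)))
    (hDsucc : ∀ (d : ℕ) (Γ : Scheme.{0}) (y : Γ), IsClosed (({y} : Set Γ)) →
      (D (d + 1) Γ y ↔ ∀ (hy : IsClosed (({y} : Set Γ))) (Z : Scheme.{0}) (τ : Z ⟶ Γ), IsBlowup τ (vanishingIdeal ⟨{y}, hy⟩) →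
        ∃ S' : Finset Z, (∀ z : Z, τ z = y → z ∉ S' → IsRegularLocalRing (Z.presheaf.stalk z)) ∧
          ∀ z ∈ S', τ z = y ∧ IsClosed (({z} : Set Z)) ∧ ∃ d' ≤ d, D d' Z z)) :
    ∀ (f : MvPolynomial (Fin 3) K), f = X 0 ^ 3 + X 1 ^ 5 + X 2 ^ 2 →
      ∀ (y₀ : Spec (CommRingCat.of (MvPolynomial (Fin 3) K ⧸ Ideal.span {f}))),
        y₀.asIdeal = Ideal.map (Ideal.Quotient.mk (Ideal.span {f})) (Ideal.span (Set.range (X : Fin 3 → MvPolynomial (Fin 3) K))) →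
        D 4 (Spec (CommRingCat.of (MvPolynomial (Fin 3) K ⧸ Ideal.span {f}))) y₀ := by
  classical
  intro f hf y₀ hy₀
  have e : (X 2 ^ 2 : MvPolynomial (Fin 3) K) + (X 0 ^ 3 + X 1 ^ 5) = f := by rw [hf]; ring
  subst e
  have hΦ : (X 2 ^ 2 : MvPolynomial (Fin 3) K).IsHomogeneous 2 := isHomogeneous_X_pow (2 : Fin 3) 2
  have hΦ0 : (X 2 ^ 2 : MvPolynomial (Fin 3) K) ≠ 0 := pow_ne_zero _ (X_ne_zero 2)
  have hΨ := SecondOrderPoint.E₈_tail_mem_pow K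
  obtain ⟨G₂, hG₂, hJ₂⟩ := SecondOrderPoint.sq_chart_vacuous₂ K hΨ
  have hG₀ := SecondOrderPoint.E₈_strictTransform₀ K
  have hG₁ := SecondOrderPoint.E₈_strictTransform₁ K
  have htr₁ : aeval (fun i : Fin 3 => X i + C ((0 : Fin 3 → K) i)) (X 1 * (X 0 ^ 3 + X 1 ^ 2) + X 2 ^ 2 : MvPolynomial (Fin 3) K) =
      X 2 ^ 2 + (X 0 ^ 3 * X 1 + X 1 ^ 3) := by
    rw [SecondOrderPoint.aeval_translate_zero]; ring
  refine towerLevel_succ_origin_marked K D hD0 hDsucc 3 (X 2 ^ 2) (X 0 ^ 3 + X 1 ^ 5) (by norm_num) hΦ hΦ0 hΨ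
    ![X 0 * (1 + X 0 * (X 0 * X 1 ^ 5)) + X 2 ^ 2, X 1 * (X 0 ^ 3 + X 1 ^ 2) + X 2 ^ 2, G₂] (fun a => ?_)
    ![∅, {(0 : Fin 3 → K)}, ∅] (fun a P hP haP hGP => ?_) (fun a lam hlam _ => ?_) y₀ hy₀
  · fin_cases a
    · exact hG₀
    · exact hG₁
    · exact hG₂
  · fin_cases a
    · exact Or.inl ⟨0, SecondOrderPoint.pderiv_graph_not_mem' K (l := 0) (by decide) _ P hP haP⟩
    · by_cases hall : ∀ j, pderiv j (X 1 * (X 0 ^ 3 + X 1 ^ 2) + X 2 ^ 2 : MvPolynomial (Fin 3) K) ∈ P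
      · right
        have h2 := SecondOrderPoint.X_two_mem_of_linear' K _ P hP haP hGP
        have hA := SecondOrderPoint.mem_of_pderiv_linear' K (l := 1) (by decide) _ P haP (hall 1)
        have h0 : (X 0 : MvPolynomial (Fin 3) K) ∈ P := by
          refine hP.mem_of_pow_mem 3 ?_
          have e : (X 0 ^ 3 : MvPolynomial (Fin 3) K) = (X 0 ^ 3 + X 1 ^ 2) - X 1 * X 1 := by ring
          rw [e]
          exact P.sub_mem hA (P.mul_mem_right _ haP)
        refine ⟨0, ?_, ?_⟩
        · exact Finset.mem_singleton_self _
        · exact SecondOrderPoint.forall_X_sub_C_zero_mem K P h0 haP h2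
      · left
        push Not at hall
        exact hall
    · exact (hJ₂ P hP haP hGP).elim
  · fin_cases a
    · exact absurd hlam (Finset.notMem_empty _)
    · have hlam0 : lam = 0 := by simpa using hlam
      subst hlam0
      exact ⟨2, X 2 ^ 2, X 0 ^ 3 * X 1 + X 1 ^ 3, by norm_num, hΦ, SecondOrderPoint.E₇_tail_mem_pow K, htr₁,
        fun y' hy' => ⟨3, le_rfl, towerLevel_origin_E₇ K D hD0 hDsucc _ (by ring) y' hy'⟩⟩
    · exact absurd hlam (Finset.notMem_empty _)

end OneStep

end Summit.ResolutionOfSingularities.ResolutionOfSingularities.Cruxes.EquisingularLiftNat.Sections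

end
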